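import Summits.RiemannHypothesis.RiemannHypothesis.Theorems.ScrewFejerWindowShiftedScrewMellin
import HarnessLib

/-!
# Landau detection for the second differences of Suzuki's screw function (RH-free engine of crux
`ScrewFejerWindow.WindowLandau`, stmt-RiemannHypothesis-23967, route `ScrewFejerWindow`, L48)

`Ψ = zetaScrew` is Suzuki's screw function of `ζ` (Suzuki 2023, J. Lond. Math. Soc. 108,
arXiv:2206.03682, (1.1)).  **Theorem (`riemannHypothesis_of_secondDiff_zetaScrew_ge`).**  If for ONE
lag `τ > 0` and some `K` one has `Ψ(t + 2τ) − 2Ψ(t + τ) + Ψ(t) ≥ −K` for all `t ≥ 0`, then RH.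
A CRITERION, not a proof of RH (the floor is RH-implied); nothing here bears on the truth of RH.

**Proof** (Montgomery–Vaughan, *Multiplicative Number Theory I*, §15.1 Lemma 15.1 = tree
`Landau.integrableOn_of_differentiableOn_union_convex`, on the pattern of
`ZetaScrewLandau.riemannXi_ne_zero_of_zetaScrew_ge_neg_slack`).  For `y > 1` put
`g(y) = Ψ(log y) − 2·𝟙_{y > e^τ} Ψ(log y − τ) + 𝟙_{y > e^{2τ}} Ψ(log y − 2τ) + K` (BACK-shifted, cut-off
copies of `Ψ∘log`: no truncated Laplace integrals appear); for `y > e^{2τ}` this is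
`Δ²_τΨ(log y − 2τ) + K ≥ 0`.  By the shift rule (`y = e^a x`)
`∫_1^∞ 𝟙_{y>e^a} Ψ(log y − a) y^{-(s+1)} dy = e^{-as} ∫_1^∞ Ψ(log x) x^{-(s+1)} dx`, the transform of `g`
on `Re s > 1` is `(1 − e^{-τs})² s^{-2}(ξ'/ξ)(1/2 + s) + L_K(s)` (Suzuki2023 Thm 1.1 (1), tree
`mellinIoi_eq_of_re_gt`; `L_K` = transform of the constant, holomorphic on `Re s > 0`), holomorphic
on `{Re s > 1}` and near the real segment `[ε₁, 3]` (no real zeros of `ξ`); Landau's lemma gives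
absolute convergence at every `σ > ε > 0`, and with `Z(s) = ξ(1/2 + s)`, `G = (M − L_K)s²` the identity
`G·Z = (1 − e^{-τs})²·Z'` on `Re s > ε` (identity theorem) is impossible at a zero `w₀` of `Z` with
`Re w₀ > ε`, because `(1 − e^{-τ w₀})² ≠ 0` (`|e^{-τ w₀}| < 1`): `ord Z − 1 = ord G + ord Z`.
-/

-- `Summit.RiemannHypothesis.RiemannHypothesis.…` repeats a component by the tree's layout (D-0017).
set_option linter.dupNamespace false

noncomputable section

open Complex Filter Topology Set MeasureTheory

namespace Summit.RiemannHypothesis.RiemannHypothesis.Theorems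

namespace ScrewFejerWindow

open Literature.NumberTheory.LFunctions Literature.NumberTheory.LFunctions.ZetaScrewLandau

/-! ### Landau detection for the second difference -/

/-- **No zeros of `ξ(1/2 + ·)` in `Re > 0` if one second difference of `Ψ` is bounded below**
(Landau's lemma, Montgomery–Vaughan Lemma 15.1, for the non-negative function
`g(y) = Ψ(log y) − 2·𝟙_{y>e^τ}Ψ(log y − τ) + 𝟙_{y>e^{2τ}}Ψ(log y − 2τ) + K` on `y > e^{2τ}`, whose
transform is `(1 − e^{-τs})² s^{-2} (ξ'/ξ)(1/2+s) + L_K(s)`: the factor `(1 − e^{-τs})²` kills the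
real singularity at `s = 0` and does not vanish in `Re s > 0`).  RH-free. -/
theorem riemannXi_ne_zero_of_secondDiff_zetaScrew_ge {τ K : ℝ} (hτ : 0 < τ)
    (hfloor : ∀ t : ℝ, 0 ≤ t →
      -K ≤ zetaScrew (t + 2 * τ) - 2 * zetaScrew (t + τ) + zetaScrew t) :
    ∀ w₀ : ℂ, 0 < w₀.re → riemannXi (1 / 2 + w₀) ≠ 0 := by
  intro w₀ hw₀ hzero
  -- zeros of `ξ(1/2 + ·)` have real part `< 1/2`
  have hw₀' : w₀.re < 1 / 2 := by
    by_contra h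
    exact riemannXi_ne_zero_of_one_le_re (by simp; linarith) hzero
  -- the pieces of `g`
  set A₁ : ℝ → ℝ := fun y ↦ (Ioi (Real.exp τ)).indicator (fun y ↦ zetaScrew (Real.log y - τ)) y
    with hA₁_def
  set A₂ : ℝ → ℝ :=
    fun y ↦ (Ioi (Real.exp (2 * τ))).indicator (fun y ↦ zetaScrew (Real.log y - 2 * τ)) y
    with hA₂_def
  set g : ℝ → ℝ := fun y ↦ zetaScrew (Real.log y) - 2 * A₁ y + A₂ y + K with hg_def
  have hg₀ : Measurable (fun x : ℝ ↦ zetaScrew (Real.log x)) :=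
    continuous_zetaScrew.measurable.comp Real.measurable_log
  have hA₁m : Measurable A₁ := measurable_indicator_zetaScrew_log_sub τ
  have hA₂m : Measurable A₂ := measurable_indicator_zetaScrew_log_sub (2 * τ)
  have hg : Measurable g := ((hg₀.sub (measurable_const.mul hA₁m)).add hA₂m).add_const K
  -- absolute convergence of the pieces
  have hΨσ : ∀ σ : ℝ, 1 / 2 < σ →
      IntegrableOn (fun x : ℝ ↦ zetaScrew (Real.log x) * x ^ (-(σ + 1))) (Ioi 1) :=
    fun σ hσ ↦ integrableOn_zetaScrew_log_rpow hσ
  have hA₁σ : ∀ σ : ℝ, 1 / 2 < σ → IntegrableOn (fun x : ℝ ↦ A₁ x * x ^ (-(σ + 1))) (Ioi 1) :=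
    fun σ hσ ↦ integrableOn_indicator_zetaScrew_log_sub_rpow hτ.le hσ
  have hA₂σ : ∀ σ : ℝ, 1 / 2 < σ → IntegrableOn (fun x : ℝ ↦ A₂ x * x ^ (-(σ + 1))) (Ioi 1) :=
    fun σ hσ ↦ integrableOn_indicator_zetaScrew_log_sub_rpow (by linarith) hσ
  have hKσ : ∀ σ : ℝ, 0 < σ → IntegrableOn (fun x : ℝ ↦ K * x ^ (-(σ + 1))) (Ioi 1) :=
    fun σ hσ ↦ (integrableOn_Ioi_rpow_of_lt (by linarith) zero_lt_one).const_mul K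
  -- the model `Φ = (1 - e^{-τ s})² R + L_K`
  set R : ℂ → ℂ := fun s ↦ 1 / s ^ 2 * logDeriv riemannXi (1 / 2 + s) with hR_def
  set P : ℂ → ℂ := fun s ↦ (1 - cexp (-(τ * s))) ^ 2 with hP_def
  set L : ℂ → ℂ := Landau.mellinIoi (fun _ : ℝ ↦ K) with hL_def
  set Φ : ℂ → ℂ := fun s ↦ P s * R s + L s with hΦ_def
  have hPd : Differentiable ℂ P := by
    rw [hP_def]
    fun_prop
  have hLd : DifferentiableOn ℂ L {s : ℂ | 0 < s.re} :=
    Landau.differentiableOn_mellinIoi_of_forall measurable_const hKσ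
  set ε : ℝ := w₀.re / 2 with hε_def
  have hε0 : 0 < ε := by rw [hε_def]; linarith
  have hε1 : ε < 1 := by linarith
  set ε₁ : ℝ := ε / 2 with hε₁_def
  have hε₁0 : 0 < ε₁ := by rw [hε₁_def]; linarith
  -- a zero-free thin rectangle around the real segment `[ε₁, 3]`
  set Kc : Set ℂ := (fun σ : ℝ ↦ (σ : ℂ)) '' Icc ε₁ 3 with hKc_def
  have hKcc : IsCompact Kc := (isCompact_Icc.image Complex.continuous_ofReal)
  set U : Set ℂ := {s : ℂ | riemannXi (1 / 2 + s) ≠ 0} with hU_def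
  have hUo : IsOpen U := by
    have : U = (fun s : ℂ ↦ riemannXi (1 / 2 + s)) ⁻¹' {0}ᶜ := rfl
    rw [this]
    exact isOpen_compl_singleton.preimage (differentiable_riemannXi.continuous.comp (by fun_prop))
  have hKU : Kc ⊆ U := by
    rintro _ ⟨σ, _, rfl⟩
    exact riemannXi_half_add_ofReal_ne_zero σ
  obtain ⟨d₀, hd₀, hthick⟩ := hKcc.exists_thickening_subset_open hUo hKU
  set W₀ : Set ℂ := {s : ℂ | ε₁ < s.re ∧ s.re < 3 ∧ -d₀ < s.im ∧ s.im < d₀} with hW₀_def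
  have hW₀eq : W₀ = {s : ℂ | ε₁ < s.re} ∩ ({s : ℂ | s.re < 3} ∩ ({s : ℂ | -d₀ < s.im} ∩
      {s : ℂ | s.im < d₀})) := by
    ext s; simp [hW₀_def]
  have hW₀o : IsOpen W₀ := by
    rw [hW₀eq]
    exact (isOpen_lt continuous_const Complex.continuous_re).inter
      ((isOpen_lt Complex.continuous_re continuous_const).inter
        ((isOpen_lt continuous_const Complex.continuous_im).inter
          (isOpen_lt Complex.continuous_im continuous_const)))
  have hW₀c : Convex ℝ W₀ := by
    rw [hW₀eq]
    exact (convex_halfSpace_re_gt _).inter ((convex_halfSpace_re_lt _).inter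
      ((convex_halfSpace_im_gt _).inter (convex_halfSpace_im_lt _)))
  have hW₀U : W₀ ⊆ U := by
    intro s hs
    refine hthick (Metric.mem_thickening_iff.2 ⟨(s.re : ℂ), ⟨s.re, ⟨hs.1.le, hs.2.1.le⟩, rfl⟩, ?_⟩)
    rw [dist_eq_norm]
    have : s - (s.re : ℂ) = (s.im : ℂ) * I := by
      apply Complex.ext <;> simp
    rw [this, norm_mul, Complex.norm_I, mul_one, Complex.norm_real, Real.norm_eq_abs, abs_lt]
    exact ⟨hs.2.2.1, hs.2.2.2⟩
  have hW₀r : ∀ σ : ℝ, ε < σ → σ ≤ 1 + 1 → (σ : ℂ) ∈ W₀ := by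
    intro σ h1 h2
    simp only [hW₀_def, Set.mem_setOf_eq, ofReal_re, ofReal_im, neg_lt_zero]
    exact ⟨by linarith, by linarith, hd₀, hd₀⟩
  -- `Φ` is holomorphic on `{Re s > 1} ∪ W₀` (both lie in `Re s > ε₁ > 0`, where `ξ(1/2+s) ≠ 0`)
  have hΦd : DifferentiableOn ℂ Φ ({s : ℂ | 1 < s.re} ∪ W₀) := by
    intro s hs
    have hsε : ε₁ < s.re := by
      rcases hs with hs | hs
      · simp only [Set.mem_setOf_eq] at hs; linarith
      · exact hs.1
    have hs0' : 0 < s.re := lt_trans hε₁0 hsε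
    have hs0 : s ≠ 0 := by
      intro h0
      rw [h0, zero_re] at hs0'
      exact lt_irrefl _ hs0'
    have hξ : riemannXi (1 / 2 + s) ≠ 0 := by
      rcases hs with hs | hs
      · exact riemannXi_ne_zero_of_one_le_re (by simp only [Set.mem_setOf_eq] at hs; simp; linarith)
      · exact hW₀U hs
    have h1 : DifferentiableAt ℂ R s := differentiableAt_R hs0 hξ
    have h2 : DifferentiableAt ℂ L s :=
      (hLd s hs0').differentiableAt ((Landau.isOpen_re_gt 0).mem_nhds hs0')
    exact (((hPd s).mul h1).add h2).differentiableWithinAt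
  -- and agrees with the transform of `g` on `Re s > 1`
  have hagree : EqOn Φ (Landau.mellinIoi g) {s : ℂ | 1 < s.re} := by
    intro s hs
    simp only [Set.mem_setOf_eq] at hs
    have hs' : 1 / 2 < s.re := by linarith
    have hI0 := integrable_ofReal_mul_cpow hg₀ (hΨσ 1 (by norm_num)) (s := s) hs
    have hI1 := integrable_ofReal_mul_cpow hA₁m (hA₁σ 1 (by norm_num)) (s := s) hs
    have hI2 := integrable_ofReal_mul_cpow hA₂m (hA₂σ 1 (by norm_num)) (s := s) hs
    have hI3 := integrable_ofReal_mul_cpow measurable_const (hKσ 1 (by norm_num)) (s := s) hs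
    have hR : R s = Landau.mellinIoi (fun x : ℝ ↦ zetaScrew (Real.log x)) s :=
      (mellinIoi_eq_of_re_gt hs').symm
    have hM1 : Landau.mellinIoi A₁ s = cexp (-(τ * s)) * R s := by
      rw [hR]
      exact mellinIoi_indicator_zetaScrew_log_sub hτ.le s
    have hM2 : Landau.mellinIoi A₂ s = cexp (-(τ * s)) ^ 2 * R s := by
      rw [hR, hA₂_def, mellinIoi_indicator_zetaScrew_log_sub (by linarith : (0 : ℝ) ≤ 2 * τ) s,
        sq, ← Complex.exp_add]
      congr 1
      push_cast
      ring
    symm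
    calc Landau.mellinIoi g s
        = ∫ x in Ioi (1 : ℝ), (((zetaScrew (Real.log x) : ℝ) : ℂ) * (x : ℂ) ^ (-(s + 1))
            - 2 * (((A₁ x : ℝ) : ℂ) * (x : ℂ) ^ (-(s + 1)))
            + ((A₂ x : ℝ) : ℂ) * (x : ℂ) ^ (-(s + 1))
            + ((K : ℝ) : ℂ) * (x : ℂ) ^ (-(s + 1))) := by
          unfold Landau.mellinIoi
          refine setIntegral_congr_fun measurableSet_Ioi fun x _ ↦ ?_
          simp only [hg_def]
          push_cast
          ring
      _ = Landau.mellinIoi (fun x : ℝ ↦ zetaScrew (Real.log x)) s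
            - 2 * Landau.mellinIoi A₁ s + Landau.mellinIoi A₂ s + L s := by
          have hI1' : Integrable (fun x : ℝ ↦ 2 * (((A₁ x : ℝ) : ℂ) * (x : ℂ) ^ (-(s + 1))))
              (volume.restrict (Ioi 1)) := hI1.const_mul 2
          have hI01 : Integrable (fun x : ℝ ↦ ((zetaScrew (Real.log x) : ℝ) : ℂ) * (x : ℂ) ^ (-(s + 1))
              - 2 * (((A₁ x : ℝ) : ℂ) * (x : ℂ) ^ (-(s + 1)))) (volume.restrict (Ioi 1)) :=
            hI0.sub hI1'
          have hI012 : Integrable (fun x : ℝ ↦ ((zetaScrew (Real.log x) : ℝ) : ℂ) * (x : ℂ) ^ (-(s + 1))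
              - 2 * (((A₁ x : ℝ) : ℂ) * (x : ℂ) ^ (-(s + 1)))
              + ((A₂ x : ℝ) : ℂ) * (x : ℂ) ^ (-(s + 1))) (volume.restrict (Ioi 1)) := hI01.add hI2
          rw [integral_add hI012 hI3, integral_add hI01 hI2, integral_sub hI0 hI1',
            integral_const_mul]
          rfl
      _ = Φ s := by
          rw [← hR, hM1, hM2]
          simp only [hΦ_def, hP_def]
          ring
  -- Landau for `g`, non-negative beyond `X₁ = e^{2τ}`: absolute convergence for every `σ > ε`
  have hint : IntegrableOn (fun x : ℝ ↦ g x * x ^ (-((1 : ℝ) + 1))) (Ioi 1) := by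
    have h0 := hΨσ 1 (by norm_num)
    have h1 := hA₁σ 1 (by norm_num)
    have h2 := hA₂σ 1 (by norm_num)
    have h3 := hKσ 1 (by norm_num)
    refine (((h0.sub (h1.const_mul 2)).add h2).add h3).congr_fun (fun x _ ↦ ?_) measurableSet_Ioi
    simp only [hg_def, Pi.add_apply, Pi.sub_apply]
    ring
  have hX₁ : (1 : ℝ) ≤ Real.exp (2 * τ) := Real.one_le_exp (by linarith)
  have hpos : ∀ x : ℝ, Real.exp (2 * τ) < x → 0 ≤ g x := by
    intro x hx
    have hx0 : 0 < x := lt_trans (Real.exp_pos _) hx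
    have hx1 : x ∈ Ioi (Real.exp τ) := by
      refine lt_trans ?_ hx
      exact Real.exp_lt_exp.2 (by linarith)
    have hx2 : x ∈ Ioi (Real.exp (2 * τ)) := hx
    have hlog : 2 * τ < Real.log x := by
      rw [← Real.log_exp (2 * τ)]
      exact Real.log_lt_log (Real.exp_pos _) hx
    have h := hfloor (Real.log x - 2 * τ) (by linarith)
    rw [show Real.log x - 2 * τ + 2 * τ = Real.log x by ring,
      show Real.log x - 2 * τ + τ = Real.log x - τ by ring] at h
    simp only [hg_def, hA₁_def, hA₂_def, Set.indicator_of_mem hx1, Set.indicator_of_mem hx2]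
    linarith
  have hS' : ∀ σ' : ℝ, ε < σ' →
      IntegrableOn (fun x : ℝ ↦ g x * x ^ (-(σ' + 1))) (Ioi 1) :=
    fun σ' hσ' ↦ Landau.integrableOn_of_differentiableOn_union_convex hg hint hX₁ hpos
      hε1 hW₀o hW₀c hW₀r hΦd hagree hσ'
  -- hence the transform `M` of `g` is holomorphic on `Re s > ε`, and equals `Φ` on `Re s > 1`
  set M : ℂ → ℂ := Landau.mellinIoi g with hM_def
  set H : Set ℂ := {s : ℂ | ε < s.re} with hH_def
  have hHo : IsOpen H := isOpen_lt continuous_const Complex.continuous_re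
  have hHpre : IsPreconnected H := (convex_halfSpace_re_gt ε).isPreconnected
  have hMd : DifferentiableOn ℂ M H := Landau.differentiableOn_mellinIoi_of_forall hg hS'
  -- `Z(s) = ξ(1/2 + s)`, `G = (M - L_K) s²`; `G · Z = (1 - e^{-τs})² · Z'` on `H`
  set Z : ℂ → ℂ := fun s ↦ riemannXi (1 / 2 + s) with hZ_def
  have hZd : Differentiable ℂ Z := differentiable_riemannXi.comp (by fun_prop)
  have hZa : ∀ s, AnalyticAt ℂ Z s := fun s ↦ hZd.analyticAt s
  have hderivZ : ∀ s, deriv Z s = deriv riemannXi (1 / 2 + s) := fun s ↦ by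
    simp only [hZ_def]
    exact deriv_comp_const_add riemannXi (1 / 2) s
  have hPa : ∀ s, AnalyticAt ℂ P s := fun s ↦ hPd.analyticAt s
  set G : ℂ → ℂ := fun s ↦ (M s - L s) * s ^ 2 with hG_def
  have hGa : ∀ s ∈ H, AnalyticAt ℂ G s := by
    intro s hs
    have hs0 : 0 < s.re := lt_trans hε0 hs
    have h1 : AnalyticAt ℂ M s := (hMd.analyticOnNhd hHo) s hs
    have h2 : AnalyticAt ℂ L s := (hLd.analyticOnNhd (Landau.isOpen_re_gt 0)) s hs0
    exact (h1.sub h2).mul (analyticAt_id.pow 2)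
  have hf₁ : AnalyticOnNhd ℂ (G * Z) H := fun s hs ↦ (hGa s hs).mul (hZa s)
  have hf₂ : AnalyticOnNhd ℂ (P * deriv Z) H := fun s _ ↦ (hPa s).mul (hZa s).deriv
  have h2H : (2 : ℂ) ∈ H := by simp [hH_def]; linarith
  have hev2 : (G * Z) =ᶠ[𝓝 (2 : ℂ)] (P * deriv Z) := by
    have hopen : IsOpen {s : ℂ | 1 < s.re} := isOpen_lt continuous_const Complex.continuous_re
    filter_upwards [hopen.mem_nhds (show (2 : ℂ) ∈ {s : ℂ | 1 < s.re} by simp)] with s hs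
    have hs' : 1 < s.re := hs
    have hξ : riemannXi (1 / 2 + s) ≠ 0 := riemannXi_ne_zero_of_one_le_re (by simp; linarith)
    have hs0 : s ≠ 0 := fun h ↦ by rw [h, zero_re] at hs'; linarith
    have hMs : M s = P s * R s + L s := (hagree hs).symm
    rw [Pi.mul_apply, Pi.mul_apply, hderivZ s]
    simp only [hG_def, hZ_def]
    rw [hMs, add_sub_cancel_right]
    simp only [hR_def]
    rw [logDeriv_apply]
    set A : ℂ := deriv riemannXi (1 / 2 + s)
    set B : ℂ := riemannXi (1 / 2 + s)
    field_simp
  have hEqOn : EqOn (G * Z) (P * deriv Z) H :=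
    hf₁.eqOn_of_preconnected_of_eventuallyEq hf₂ hHpre h2H hev2
  -- orders at `w₀`
  have hw₀H : w₀ ∈ H := by simp [hH_def]; linarith
  have hev : (P * deriv Z) =ᶠ[𝓝 w₀] G * Z := by
    filter_upwards [hHo.mem_nhds hw₀H] with s hs
    exact (hEqOn hs).symm
  have hP0 : P w₀ ≠ 0 := by
    simp only [hP_def]
    refine pow_ne_zero 2 (sub_ne_zero.2 ?_)
    intro h
    have hn : ‖cexp (-(τ * w₀))‖ = 1 := by rw [← h]; simp
    rw [Complex.norm_exp] at hn
    have hre : (-((τ : ℂ) * w₀)).re = -(τ * w₀.re) := by simp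
    rw [hre] at hn
    have hneg : -(τ * w₀.re) < 0 := by nlinarith
    have := Real.exp_lt_one_iff.2 hneg
    linarith
  have hordP : analyticOrderAt P w₀ = 0 := (hPa w₀).analyticOrderAt_eq_zero.2 hP0
  have hZ0 : Z w₀ = 0 := hzero
  have h1 : analyticOrderAt (deriv Z) w₀ + 1 = analyticOrderAt Z w₀ := by
    have := (hZa w₀).analyticOrderAt_deriv_add_one
    simpa [hZ0] using this
  have hPZ : analyticOrderAt (P * deriv Z) w₀ = analyticOrderAt (deriv Z) w₀ := by
    rw [analyticOrderAt_mul (hPa w₀) (hZa w₀).deriv, hordP, zero_add]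
  have h2 : analyticOrderAt (deriv Z) w₀ = analyticOrderAt G w₀ + analyticOrderAt Z w₀ := by
    rw [← hPZ, analyticOrderAt_congr hev, analyticOrderAt_mul (hGa w₀ hw₀H) (hZa w₀)]
  rw [h2] at h1
  -- `Z` is not locally zero (else `ξ ≡ 0`), so its order is finite, contradiction
  generalize hoZ : analyticOrderAt Z w₀ = oZ at h1
  generalize hoG : analyticOrderAt G w₀ = oG at h1
  cases oZ with
  | top =>
    have hloc : ∀ᶠ s in 𝓝 w₀, Z s = 0 := analyticOrderAt_eq_top.1 hoZ
    have hall : EqOn Z 0 univ :=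
      (hZd.differentiableOn.analyticOnNhd isOpen_univ).eqOn_zero_of_preconnected_of_eventuallyEq_zero
        isPreconnected_univ (Set.mem_univ w₀) hloc
    have h1' : Z 1 = 0 := hall (Set.mem_univ 1)
    simp only [hZ_def] at h1'
    exact riemannXi_ne_zero_of_one_le_re (s := 1 / 2 + 1) (by norm_num) h1'
  | coe n =>
    cases oG with
    | top => simp at h1
    | coe m =>
      have h' : (m + n + 1 : ℕ) = n := by exact_mod_cast h1
      omega

/-- **Bounded second differences of `Ψ` at one lag imply RH** (`ζ`-language: no zero of
`ξ(1/2 + ·)` in `Re > 0`, i.e. none of `ζ` in `1/2 < Re s < 1`, which is RH by the functional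
equation, `quasiRiemannHypothesis_one_half_iff_holds`).  RH-free criterion; the hypothesis is the
route's residual `WindowFloor` (RH-implied).  Nothing here bears on the truth of RH. -/
theorem riemannHypothesis_of_secondDiff_zetaScrew_ge {τ K : ℝ} (hτ : 0 < τ)
    (hfloor : ∀ t : ℝ, 0 ≤ t →
      -K ≤ zetaScrew (t + 2 * τ) - 2 * zetaScrew (t + τ) + zetaScrew t) :
    _root_.RiemannHypothesis := by
  refine quasiRiemannHypothesis_one_half_iff_holds.1 fun s hs h1 h2 ↦ ?_
  have hξ : riemannXi s = 0 := (riemannXi_eq_zero_iff_holds s).2 ⟨hs, by linarith, h2⟩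
  have hw : 0 < (s - 1 / 2).re := by simp; linarith
  refine riemannXi_ne_zero_of_secondDiff_zetaScrew_ge hτ hfloor (s - 1 / 2) hw ?_
  rw [show (1 / 2 : ℂ) + (s - 1 / 2) = s by ring]
  exact hξ

end ScrewFejerWindow

end Summit.RiemannHypothesis.RiemannHypothesis.Theorems

end
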